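import Summits.BirchSwinnertonDyer.BirchSwinnertonDyer.Theorems.GenusKolyvaginAtTwoK4NegBetaFrameDeepPrimeSupply
import HarnessLib

/-!
# Route `GenusKolyvaginAtTwo`, crux K₄⁻ `K4Neg` (stmt-BirchSwinnertonDyer-31526), the (β)-residual F4ᶠ —
# THE (β)-SUPPLY ONE LEVEL UP, MINUS CASE: points of `E` itself in the `c₀ = −1` part (the twin's generator read in `E(K)⁻`)

Width seat `bsd-line-gk2-p5` g43 (cell `bsd-f1-sign2`), WIDTH-5 attach on route `GenusKolyvaginAtTwo` rev 59, lane «the (β)-residual of K₄⁻».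
`--supports stmt-BirchSwinnertonDyer-31526 --as helper`.  THEOREMS ONLY (no definition, no named fact, no `sorry`); standard axioms.
**BSD is NOT proved by this file; `K4Neg` is NOT proved; no item is closed by it.**

`…BetaFrameDeepPrimeSupply` (gk2-p5 g43, p792420) supplies deep `FrobEqFrobInfty` Kolyvagin primes seeing the top bit of the level-`4` Kummer class of a
point `R` FIXED by `Γ_ℚ` (plus case: the twin's generator on the twin `Wd`).  The LEAD's / gk2-p3's currency for the (β)-frame is the MINUS one:
`R ∈ E(K)` is the twin's generator transported INTO `E`, so complex conjugation acts on it by `−1` and only `Γ_K` fixes it.  THIS FILE is the minus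
case, on the points of `E` itself, with an extra `K`-side output: a Frobenius `τ ∈ Γ_K` at the prime `w = λ` of `K` over `ℓ` with `res τ = h·h` — the
element at which `K`-side classes are evaluated (`[κ, τ] = τ·Q_K − Q_K`, `H¹_ur(K_λ, E[4]) = E[4]`).

* §1 `conj_smul_sub_eq_of_smul_eq_neg'` — `Γ`-equivariance of `γ ↦ γ·Q − Q` under a `σ` with `σ·R = −R` (the plus version is file 2's
  `conj_smul_sub_eq`); `exists_mem_conj_sq_smul_sub_ne_of_smul_eq_neg` — the top-bit flip inside a conjugation-stable `H` for `R` with `σ·R = ±R`.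
* §2 ★★★ `exists_deep_frobEqFrobInfty_prime_sq_smul_sub_ne_of_smul_eq_neg` — **THE SUPPLY, MINUS CASE**: `W/ℚ` globally minimal, `K` imaginary
  quadratic, `c₀` a complex conjugation moving a point of `E[2]` with `c₀·R = −R`, every `σ ∈ Γ_ℚ` acting on `R` by `±1`; `2Q' = R`, `2Q = Q'`; `H ≤ Γ_ℚ`
  open, conjugation-stable, fixing `E[4]`, `K` and `Q'`, with an element moving `Q`; no non-zero `Γ_ℚ`-fixed `2`-torsion.  Then beyond every bound a
  prime `ℓ` with `ℓ ∤ N d_K`, `ℓ ≠ 2`, `(ℓ)` prime in `𝓞_K`, `FrobEqFrobInfty W K 4 ℓ`, `4 ∣ ℓ+1`, `4 ∣ a_ℓ`, a Frobenius `h` at `ℓ` (`= c₀` on `E[4]`) with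
  **`h·h·Q − Q ≠ 0`**, AND a place `w` of `K` over `ℓ` with a Frobenius `τ ∈ Γ_K` at `w`, `res_{K/ℚ} τ = h·h`.
* §3 `exists_kolyvaginPrime_deep_sq_smul_sub_ne_of_smul_eq_neg` — the same in K4Neg's witness-prime currency.

READING (census; nothing closed).  With gk2-p3's `RatClosure.pointsEquiv` dictionary (`θ(res τ · P) = τ · θ P`) the output reads, for the
`K`-side quarter `Q_K = θ Q` of the generator: `τ·Q_K − Q_K = θ(h·h·Q − Q) ≠ 0`, i.e. `[κ₄(R), Frob_λ] ≠ 0` — the level-`4` Kummer class of the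
generator is ALIVE at `λ`, at a deep prime of K4Neg's witness type, on a (β)-frame.  BSD is NOT proved by any of this.

References: [McCallumLMS1991] §3 Prop. 3.1, Cor. 3.2; [GrossLMS1991] §3 (3.1)–(3.3), §9 Prop. 9.6; [MazurRubin2010] Lemma 3.5; [LawsonWuthrich2016] §3, §7.1;
[SilvermanAEC2009] VII.4.1, VIII.§2.
-/

set_option linter.dupNamespace false -- `Summit.<P>.<Sub>` repeats `BirchSwinnertonDyer` (D-0017)
set_option autoImplicit false

noncomputable section

open scoped Classical Pointwise

namespace Summit.BirchSwinnertonDyer.BirchSwinnertonDyer.Theorems.GenusExact.Lw2PhantomExclusion.DeepPrimeOneBit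

open WeierstrassCurve Field NumberField IsDedekindDomain
open Literature.NumberTheory.GaloisRepresentations Literature.NumberTheory.EllipticCurves
open Literature.NumberTheory
open Rat.HeightOneSpectrum
open Summit.BirchSwinnertonDyer.BirchSwinnertonDyer.Theorems.GenusKolyTwistingPrime

variable (W : WeierstrassCurve ℚ) [W.IsElliptic]

/-! ## §1 Equivariance under a sign-reversing `σ`, and the flip inside `H` (minus case) -/

omit [W.IsElliptic] in
/-- **Conjugating by `σ` with `σ·R = −R`**: for `γ` fixing the `4`-division points and `Q'`, `σγσ⁻¹` fixes them too and `(σγσ⁻¹)·Q − Q = σ·(γ·Q − Q)`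
(`σ⁻¹·Q' + Q'` and `σ⁻¹·Q + Q` are killed by `4`; `−e = e` on `2`-torsion). [cite: GrossLMS1991, §9 (pairing after Prop. 9.1)] -/
theorem conj_smul_sub_eq_of_smul_eq_neg' {σ γ : absoluteGaloisGroup ℚ} (hγ4 : ∀ P : geomPoints W, (4 : ℤ) • P = 0 → γ • P = P)
    {R Q' Q : geomPoints W} (hQ' : (2 : ℤ) • Q' = R) (hQ : (2 : ℤ) • Q = Q') (hγQ' : γ • Q' = Q') (hσR : σ • R = -R) :
    (∀ P : geomPoints W, (4 : ℤ) • P = 0 → (σ * γ * σ⁻¹) • P = P) ∧ (σ * γ * σ⁻¹) • Q' = Q' ∧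
      (σ * γ * σ⁻¹) • Q - Q = σ • (γ • Q - Q) := by
  have hσR' : σ⁻¹ • R = -R := by
    rw [inv_smul_eq_iff, smul_neg, hσR, neg_neg]
  have h4Q : (4 : ℤ) • Q = R := by
    rw [show (4 : ℤ) = 2 * 2 by norm_num, mul_smul, hQ, hQ']
  refine ⟨fun P hP ↦ ?_, ?_, ?_⟩
  · have hP' : (4 : ℤ) • (σ⁻¹ • P) = 0 := by rw [smul_comm, hP, smul_zero]
    rw [mul_smul, mul_smul, hγ4 _ hP', smul_inv_smul]
  · -- `f' := σ⁻¹·Q' + Q'` is killed by `2`, hence by `4`; `γ` fixes it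
    have hf' : (4 : ℤ) • (σ⁻¹ • Q' + Q') = 0 := by
      rw [show (4 : ℤ) = 2 * 2 by norm_num, mul_smul, smul_add, smul_comm (2 : ℤ) σ⁻¹ Q', hQ', hσR', neg_add_cancel, smul_zero]
    have hγf' : γ • (σ⁻¹ • Q' + Q') = σ⁻¹ • Q' + Q' := hγ4 _ hf'
    have h1 : σ⁻¹ • Q' = (σ⁻¹ • Q' + Q') - Q' := by abel
    rw [mul_smul, mul_smul, h1, smul_sub, hγQ', hγf', ← h1, smul_inv_smul]
  · -- `f := σ⁻¹·Q + Q` is killed by `4`; `γ` fixes it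
    have hf : (4 : ℤ) • (σ⁻¹ • Q + Q) = 0 := by
      rw [smul_add, smul_comm (4 : ℤ) σ⁻¹ Q, h4Q, hσR', neg_add_cancel]
    have hγf : γ • (σ⁻¹ • Q + Q) = σ⁻¹ • Q + Q := hγ4 _ hf
    have he2 : (2 : ℤ) • (γ • Q - Q) = 0 := two_zsmul_smul_sub_eq_zero W hQ hγQ'
    have hneg : -(γ • Q - Q) = γ • Q - Q := neg_eq_self_of_two_zsmul_eq_zero W he2
    have h1 : σ⁻¹ • Q = (σ⁻¹ • Q + Q) - Q := by abel
    have h2 : γ • σ⁻¹ • Q = σ⁻¹ • Q - (γ • Q - Q) := by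
      rw [h1, smul_sub, hγf]; abel
    rw [mul_smul, mul_smul, h2, smul_sub, smul_inv_smul]
    have h3 : Q - σ • (γ • Q - Q) - Q = -(σ • (γ • Q - Q)) := by abel
    rw [h3, ← smul_neg, hneg]

/-- **Top-bit flip inside `H`, minus case.**  `g·g = 1` on the `4`-division points, `g` moves a `2`-torsion point, `g·R = −R`, every `σ ∈ Γ_ℚ` acts
on `R` by `±1`; `2Q' = R`, `2Q = Q'`; `H` conjugation-stable, fixing the `4`-division points and `Q'`, with an element moving `Q`; no non-zero
`Γ_ℚ`-fixed `2`-torsion.  Then some `γ ∈ H` has `(gγ)·(gγ)·Q − Q ≠ g·g·Q − Q`. [cite: GrossLMS1991, §9 Prop. 9.1, 9.6] [cite: MazurRubin2010, Lemma 3.5] -/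
theorem exists_mem_conj_sq_smul_sub_ne_of_smul_eq_neg {g : absoluteGaloisGroup ℚ}
    (hg4 : ∀ P : geomPoints W, (4 : ℤ) • P = 0 → g • g • P = P)
    (hge : ∃ e : geomPoints W, (2 : ℤ) • e = 0 ∧ g • e ≠ e)
    {R Q' Q : geomPoints W} (hgR : g • R = -R) (hR : ∀ σ : absoluteGaloisGroup ℚ, σ • R = R ∨ σ • R = -R)
    (hQ' : (2 : ℤ) • Q' = R) (hQ : (2 : ℤ) • Q = Q')
    {H : Subgroup (absoluteGaloisGroup ℚ)} (hH4 : ∀ γ ∈ H, ∀ P : geomPoints W, (4 : ℤ) • P = 0 → γ • P = P)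
    (hHQ' : ∀ γ ∈ H, γ • Q' = Q') (hHn : ∀ (σ : absoluteGaloisGroup ℚ), ∀ γ ∈ H, σ * γ * σ⁻¹ ∈ H)
    (hN : ∃ γ₀ ∈ H, γ₀ • Q ≠ Q)
    (hirr : ∀ m : geomPoints W, (2 : ℤ) • m = 0 → m ≠ 0 → ∃ σ : absoluteGaloisGroup ℚ, σ • m ≠ m) :
    ∃ γ ∈ H, (g * γ) • (g * γ) • Q - Q ≠ g • g • Q - Q := by
  obtain ⟨e, he, hge⟩ := hge
  obtain ⟨γ₀, hγ₀H, hγ₀Q⟩ := hN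
  have hgg : ∀ P : geomPoints W, (2 : ℤ) • P = 0 → g • g • P = P := fun P hP ↦
    hg4 P (by rw [show (4 : ℤ) = 2 * 2 by norm_num, mul_smul, hP, smul_zero])
  have he₀2 : (2 : ℤ) • (γ₀ • Q - Q) = 0 := two_zsmul_smul_sub_eq_zero W hQ (hHQ' γ₀ hγ₀H)
  have he₀0 : γ₀ • Q - Q ≠ 0 := fun h ↦ hγ₀Q (sub_eq_zero.mp h)
  by_cases hfix : g • (γ₀ • Q - Q) = γ₀ • Q - Q
  · obtain ⟨σ, hσe⟩ := hirr _ he₀2 he₀0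
    -- `σ` acts on `R` by `±1`; in both cases `σγ₀σ⁻¹ ∈ H` fixes the `4`-division points and `Q'`, and moves `Q` by `σ·e₀`
    have hconj : (∀ P : geomPoints W, (4 : ℤ) • P = 0 → (σ * γ₀ * σ⁻¹) • P = P) ∧ (σ * γ₀ * σ⁻¹) • Q' = Q' ∧
        (σ * γ₀ * σ⁻¹) • Q - Q = σ • (γ₀ • Q - Q) := by
      rcases hR σ with hσR | hσR
      · exact conj_smul_sub_eq W (hH4 γ₀ hγ₀H) hQ' hQ (hHQ' γ₀ hγ₀H) hσR
      · exact conj_smul_sub_eq_of_smul_eq_neg' W (hH4 γ₀ hγ₀H) hQ' hQ (hHQ' γ₀ hγ₀H) hσR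
    obtain ⟨hγ4, hγQ', hγQ⟩ := hconj
    refine ⟨σ * γ₀ * σ⁻¹, hHn σ γ₀ hγ₀H, fun h ↦ ?_⟩
    rw [conj_sq_smul_sub_eq_iff_of_smul_eq_neg W hg4 hγ4 hgR hQ' hQ hγQ', hγQ] at h
    have hσe2 : (2 : ℤ) • (σ • (γ₀ • Q - Q)) = 0 := by rw [smul_comm, he₀2, smul_zero]
    have hσe0 : σ • (γ₀ • Q - Q) ≠ 0 := fun h0 ↦ he₀0 (by
      have := congrArg (fun P ↦ σ⁻¹ • P) h0
      simpa only [inv_smul_smul, smul_zero] using this)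
    have h1 := two_torsion_fixed_eq_zero_or_eq_add W hgg he hge hσe2 h
    have h2 := two_torsion_fixed_eq_zero_or_eq_add W hgg he hge he₀2 hfix
    rcases h1 with h1 | h1
    · exact hσe0 h1
    rcases h2 with h2 | h2
    · exact he₀0 h2
    exact hσe (by rw [h1, ← h2])
  · exact ⟨γ₀, hγ₀H, fun h ↦
      hfix ((conj_sq_smul_sub_eq_iff_of_smul_eq_neg W hg4 (hH4 γ₀ hγ₀H) hgR hQ' hQ (hHQ' γ₀ hγ₀H)).mp h)⟩

/-! ## §2 ★★★ The supply, minus case, with the `K`-side Frobenius -/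

/-- ★★★ **THE (β)-SUPPLY ONE LEVEL UP, MINUS CASE.**  `W/ℚ` globally minimal, `K` imaginary quadratic, `N ≥ 1`; `c₀ ∈ Γ_ℚ` a complex conjugation
moving a point of `E[2]`; `R ∈ E(ℚ̄)` with `c₀·R = −R` and every `σ ∈ Γ_ℚ` acting on `R` by `±1`, `2Q' = R`, `2Q = Q'`; `H ≤ Γ_ℚ` OPEN and conjugation-stable, every element of which
fixes `E[4]`, the field `K ⊂ ℚ̄` pointwise and the half `Q'`; some element of `H` moves `Q`; no non-zero point of `E[2]` is `Γ_ℚ`-fixed.  Then for every `b` there is a prime `ℓ > b` with `ℓ ∤ N`, `ℓ ∤ d_K`, `ℓ ≠ 2`, `(ℓ)` prime in `𝓞 K`,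
`FrobEqFrobInfty W K 4 ℓ`, `4 ∣ ℓ + 1`, `4 ∣ a_ℓ(W)` (a DEEP Kolyvagin prime of K4Neg's witness type), and an arithmetic Frobenius `h` at `ℓ` acting
on `E[4]` as `c₀` with **`h·h·Q − Q ≠ 0`**, AND a place `w` of `K` over `ℓ` with a Frobenius `τ ∈ Γ_K` at `w` restricting to `h·h` (the `K`-side
evaluation element).  Proof: §1 with `g = c₀` (`c₀² = 1`) gives `γ ∈ H` with `(c₀γ)²Q ≠ Q`; Čebotarev (`frobenius_dense`) in the open set `c₀γ·(H ∩ Stab Q ∩ Stab(c₀γQ))`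
away from the primes of `2 N d_K`, the primes `≤ b`, the places ramified in `K` and the bad places of `W` gives `h = c₀γn` with `h·h·Q = (c₀γ)²Q`;
`h ∉ Γ_K` makes `ℓ` inert (`exists_place_inert_of_not_mem_range`); `h = c₀` on `W[4]` and on `K` is `FrobEqFrobInfty W K 4 ℓ`, whence
`4 ∣ ℓ + 1`, `4 ∣ a_ℓ` (`pow_dvd_add_one_of_frobEqFrobInfty`, `pow_dvd_frobeniusTraceAt_of_frobEqFrobInfty`).
[cite: McCallumLMS1991, §3 Prop. 3.1, Cor. 3.2] [cite: GrossLMS1991, §3 (3.2)–(3.3)] [cite: MazurRubin2010, Lemma 3.5] -/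
theorem exists_deep_frobEqFrobInfty_prime_sq_smul_sub_ne_of_smul_eq_neg [W.IsGloballyMinimal]
    {K : Type} [Field K] [NumberField K] (hK : IsImaginaryQuadratic K) (N : ℕ) [NeZero N]
    {c₀ : absoluteGaloisGroup ℚ} (hc₀ : IsComplexConjugation (Rat.castHom ℝ) c₀)
    (hce : ∃ e : geomPoints W, (2 : ℤ) • e = 0 ∧ c₀ • e ≠ e)
    {R Q' Q : geomPoints W} (hc₀R : c₀ • R = -R) (hR : ∀ σ : absoluteGaloisGroup ℚ, σ • R = R ∨ σ • R = -R)
    (hQ' : (2 : ℤ) • Q' = R) (hQ : (2 : ℤ) • Q = Q')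
    {H : Subgroup (absoluteGaloisGroup ℚ)} (hHopen : IsOpen (H : Set (absoluteGaloisGroup ℚ)))
    (hHn : ∀ (σ : absoluteGaloisGroup ℚ), ∀ γ ∈ H, σ * γ * σ⁻¹ ∈ H)
    (hHW : ∀ γ ∈ H, ∀ P : geomTorsion W ((2 ^ 2 : ℕ) : ℤ), γ • P = P)
    (hHK : ∀ γ ∈ H, ∀ x : K, γ • absEmbedding ℚ K x = absEmbedding ℚ K x)
    (hHQ' : ∀ γ ∈ H, γ • Q' = Q') (hN : ∃ γ₀ ∈ H, γ₀ • Q ≠ Q)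
    (hirr : ∀ m : geomPoints W, (2 : ℤ) • m = 0 → m ≠ 0 → ∃ σ : absoluteGaloisGroup ℚ, σ • m ≠ m) (b : ℕ) :
    ∃ ℓ : ℕ, b < ℓ ∧ ℓ.Prime ∧ ¬ ℓ ∣ N ∧ ¬ ((ℓ : ℤ) ∣ NumberField.discr K) ∧ ℓ ≠ 2 ∧
      (Ideal.span {(ℓ : 𝓞 K)}).IsPrime ∧ FrobEqFrobInfty W K (2 ^ 2) ℓ ∧ 2 ^ 2 ∣ ℓ + 1 ∧ ((2 : ℤ) ^ 2) ∣ W.frobeniusTrace ℓ ∧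
      ∃ (v : HeightOneSpectrum (𝓞 ℚ)) (𝔓 : Ideal (absIntegers (𝓞 ℚ) ℚ)) (h : absoluteGaloisGroup ℚ),
        (ℓ : 𝓞 ℚ) ∈ v.asIdeal ∧ 𝔓 ∈ v.primesAbove ∧ IsArithFrobAt (𝓞 ℚ) h 𝔓 ∧
        (∀ P : geomTorsion W ((2 ^ 2 : ℕ) : ℤ), h • P = c₀ • P) ∧ h • h • Q - Q ≠ 0 ∧
        ∃ (w : HeightOneSpectrum (𝓞 K)) (𝔔 : Ideal (absIntegers (𝓞 K) K)) (τ : absoluteGaloisGroup K),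
          w.under (𝓞 ℚ) = v ∧ (ℓ : 𝓞 K) ∈ w.asIdeal ∧ 𝔔 ∈ w.primesAbove ∧ IsArithFrobAt (𝓞 K) τ 𝔔 ∧ absGaloisRestrict ℚ K τ = h * h := by
  classical
  have hp : Nat.Prime 2 := Nat.prime_two
  haveI : Fact (Nat.Prime 2) := ⟨hp⟩
  haveI : Algebra.IsQuadraticExtension ℚ K := ⟨hK.1⟩
  haveI : IsTotallyComplex K := hK.2
  -- ### Step A: `c₀` is an involution, so `c₀·c₀` fixes everything
  have hc1 : c₀ * c₀ = 1 := by rw [← sq]; exact hc₀.sq_eq_one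
  have hg4 : ∀ P : geomPoints W, (4 : ℤ) • P = 0 → c₀ • c₀ • P = P := fun P _ ↦ by rw [← mul_smul, hc1, one_smul]
  have hHV : ∀ γ ∈ H, ∀ P : geomPoints W, (4 : ℤ) • P = 0 → γ • P = P := fun γ hγ P hP ↦ by
    have := hHW γ hγ ⟨P, (WeierstrassCurve.mem_geomTorsion_iff W _ P).mpr (by exact_mod_cast hP)⟩
    simpa only [AddSubgroup.torsionBy.coe_smul] using congrArg Subtype.val this
  -- ### Step B: the flip inside `H`
  obtain ⟨γ, hγH, hflip⟩ := exists_mem_conj_sq_smul_sub_ne_of_smul_eq_neg W hg4 hce hc₀R hR hQ' hQ hHV hHQ' hHn hN hirr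
  have hγγ : (c₀ * γ) • (c₀ * γ) • Q - Q ≠ 0 := by
    intro h0
    apply hflip
    rw [h0, ← mul_smul, hc1, one_smul, sub_self]
  -- ### Step C: the finite exceptional set of places of `ℚ`
  have hbad₀ : (W.badPlaces (𝓞 ℚ)).Finite := W.finite_badPlaces_holds (𝓞 ℚ)
  set B : Finset ℕ := {2} ∪ N.primeFactors ∪ (NumberField.discr K).natAbs.primeFactors ∪ Finset.range (b + 1) with hB
  set S₁ : Set (HeightOneSpectrum (𝓞 ℚ)) := {v | ∃ q ∈ B, q.Prime ∧ (q : 𝓞 ℚ) ∈ v.asIdeal} with hS₁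
  set S₂ : Set (HeightOneSpectrum (𝓞 ℚ)) := {v | ¬ Algebra.IsUnramifiedIn (𝓞 K) v.asIdeal} with hS₂
  have hS₁fin : S₁.Finite := by
    have : S₁ ⊆ ⋃ q ∈ (B.filter Nat.Prime), {v | (q : 𝓞 ℚ) ∈ v.asIdeal} := by
      intro v ⟨q, hqB, hq, hqv⟩
      simp only [Set.mem_iUnion, Finset.mem_filter]
      exact ⟨q, ⟨hqB, hq⟩, hqv⟩
    refine Set.Finite.subset (Set.Finite.biUnion (Finset.finite_toSet _) fun q hq ↦ ?_) this
    rw [Finset.coe_filter, Set.mem_setOf_eq] at hq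
    have hsub : {v : HeightOneSpectrum (𝓞 ℚ) | (q : 𝓞 ℚ) ∈ v.asIdeal}.Subsingleton :=
      fun v hv v' hv' ↦ HeightOneSpectrum.eq_of_natCast_mem_rat hq.2 hv hv'
    exact hsub.finite
  have hS₂fin : S₂.Finite := finite_setOf_not_isUnramifiedIn ℚ K
  set S := S₁ ∪ S₂ ∪ W.badPlaces (𝓞 ℚ) with hSdef
  have hSfin : S.Finite := (hS₁fin.union hS₂fin).union hbad₀
  -- ### Step D: Čebotarev in `Γ_ℚ`: a Frobenius in the open set `c₀γ · (H ∩ Stab Q ∩ Stab (c₀γ·Q))`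
  set A₁ : Subgroup (absoluteGaloisGroup ℚ) := MulAction.stabilizer (absoluteGaloisGroup ℚ) Q with hA₁
  set A₂ : Subgroup (absoluteGaloisGroup ℚ) := MulAction.stabilizer (absoluteGaloisGroup ℚ) ((c₀ * γ) • Q) with hA₂
  have hA₁open : IsOpen (A₁ : Set (absoluteGaloisGroup ℚ)) := W.isOpen_stabilizer_point_holds Q
  have hA₂open : IsOpen (A₂ : Set (absoluteGaloisGroup ℚ)) := W.isOpen_stabilizer_point_holds ((c₀ * γ) • Q)
  set U : Set (absoluteGaloisGroup ℚ) := ((H : Set _) ∩ (A₁ : Set _)) ∩ (A₂ : Set _) with hU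
  have hUopen : IsOpen U := (hHopen.inter hA₁open).inter hA₂open
  set O : Set (absoluteGaloisGroup ℚ) := (fun n ↦ c₀ * γ * n) '' U with hO
  have hOopen : IsOpen O := (Homeomorph.mulLeft (c₀ * γ)).isOpenMap _ hUopen
  have hOne : O.Nonempty := ⟨c₀ * γ * 1, 1, ⟨⟨H.one_mem, A₁.one_mem⟩, A₂.one_mem⟩, rfl⟩
  obtain ⟨h, hhO, v, hvS, 𝔓₀, h𝔓₀, hh⟩ :=
    (absoluteGaloisGroup.frobenius_dense Automorphic.chebotarev_artinRep_holds ℚ S hSfin).inter_open_nonempty O hOopen hOne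
  obtain ⟨n, ⟨⟨hnH, hnA₁⟩, hnA₂⟩, rfl⟩ := hhO
  have hnQ : n • Q = Q := hnA₁
  have hnQ₁ : n • ((c₀ * γ) • Q) = (c₀ * γ) • Q := hnA₂
  -- the point identity `h·h·Q = (c₀γ)·(c₀γ)·Q`
  have hhhQ : (c₀ * γ * n) • (c₀ * γ * n) • Q = (c₀ * γ) • (c₀ * γ) • Q := by
    rw [mul_smul (c₀ * γ) n, mul_smul (c₀ * γ) n, hnQ, hnQ₁]
  -- `γ n ∈ H` fixes `W[4]` and `K`
  have hγn : γ * n ∈ H := mul_mem hγH hnH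
  have hrK : γ * n ∈ (absGaloisRestrict ℚ K).range :=
    (mem_range_absGaloisRestrict_iff_smul_absEmbedding (F := ℚ) (M := K) (γ * n)).mpr (hHK _ hγn)
  obtain ⟨g', hg'⟩ := hrK
  -- ### Step E: the rational prime `ℓ` under `v`
  obtain ⟨ℓ, hℓ, hℓv⟩ := exists_prime_natCast_mem v
  have hℓB : ℓ ∉ B := fun hmem ↦ hvS (Or.inl (Or.inl ⟨ℓ, hmem, hℓ, hℓv⟩))
  simp only [hB, Finset.mem_union, Finset.mem_singleton, Nat.mem_primeFactors, Finset.mem_range, not_or] at hℓB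
  obtain ⟨⟨⟨hℓp, hℓN⟩, hℓD⟩, hℓb⟩ := hℓB
  have hℓN' : ¬ ℓ ∣ N := fun hd ↦ hℓN ⟨hℓ, hd, NeZero.ne N⟩
  have hℓD' : ¬ ((ℓ : ℤ) ∣ NumberField.discr K) := fun hd ↦
    hℓD ⟨hℓ, Int.natAbs_dvd_natAbs.mpr hd |>.trans (by simp), by simp [NumberField.discr_ne_zero]⟩
  have hbℓ : b < ℓ := by omega
  have hunr : Algebra.IsUnramifiedIn (𝓞 K) v.asIdeal := by
    by_contra hcon; exact hvS (Or.inl (Or.inr hcon))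
  have hgood₀ : W.HasGoodReductionAt v := by
    by_contra hcon; exact hvS (Or.inr hcon)
  -- ### Step F: `ℓ` is inert in `K`
  have hHi := index_range_absGaloisRestrict_eq_finrank ℚ K
  haveI hRn : ((absGaloisRestrict ℚ K).range).Normal := Subgroup.normal_of_index_eq_two (hHi.trans hK.1)
  have hI := inertia_le_range_absGaloisRestrict_of_isUnramifiedIn (K := K) hunr h𝔓₀
  have hΦH : c₀ * γ * n ∉ (absGaloisRestrict ℚ K).range := by
    intro hmem
    apply hc₀.not_mem_range_absGaloisRestrict (L := K) IsTotallyComplex.isComplex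
    change c₀ ∈ ((absGaloisRestrict ℚ K).range : Set (absoluteGaloisGroup ℚ))
    have h' : c₀ = c₀ * γ * n * (γ * n)⁻¹ := by group
    rw [SetLike.mem_coe, h']
    exact Subgroup.mul_mem _ hmem (Subgroup.inv_mem _ ⟨g', hg'⟩)
  obtain ⟨w, 𝔔, τ', hwv, hwuniq, -, h𝔔w, -, hτ', hresτ'⟩ :=
    exists_place_inert_of_not_mem_range (F := ℚ) (M := K) (hK.1 ▸ Nat.prime_two) hRn (hHi.trans rfl) hunr h𝔓₀ hI hh hΦH
  have hℓw : (ℓ : 𝓞 K) ∈ w.asIdeal := by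
    have h1 : (ℓ : 𝓞 ℚ) ∈ (w.under (𝓞 ℚ)).asIdeal := by rw [hwv]; exact hℓv
    rw [HeightOneSpectrum.under_asIdeal, Ideal.under_def, Ideal.mem_comap, map_natCast] at h1
    exact h1
  have hwuniq' : ∀ w' : HeightOneSpectrum (𝓞 K), (ℓ : 𝓞 K) ∈ w'.asIdeal → w' = w := by
    intro w' hw'
    apply hwuniq
    apply HeightOneSpectrum.eq_of_natCast_mem_rat hℓ _ hℓv
    rw [HeightOneSpectrum.under_asIdeal, Ideal.under_def, Ideal.mem_comap, map_natCast]
    exact hw'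
  have hspan : Ideal.span {(ℓ : 𝓞 K)} = w.asIdeal := by
    apply span_natCast_eq_of_unique hℓ w hwuniq'
    haveI : w.asIdeal.LiesOver v.asIdeal := ⟨by rw [← hwv]; rfl⟩
    have hmap : v.asIdeal.map (algebraMap (𝓞 ℚ) (𝓞 K)) = Ideal.span {(ℓ : 𝓞 K)} := by
      rw [← span_natCast_rat_eq hℓ hℓv, Ideal.map_span, Set.image_singleton, map_natCast]
    have hne : v.asIdeal.map (algebraMap (𝓞 ℚ) (𝓞 K)) ≠ ⊥ := by
      rw [hmap, Ne, Ideal.span_singleton_eq_bot]; exact_mod_cast hℓ.ne_zero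
    rw [← hmap, ← Ideal.IsDedekindDomain.ramificationIdx_eq_normalizedFactors_count v.asIdeal w.asIdeal hne]
    exact Ideal.ramificationIdx_eq_one_iff.mpr (hunr w.asIdeal w.isPrime inferInstance)
  -- ### Step G: `h` acts on `W[4]` and on `K` as `c₀`: `FrobEqFrobInfty W K 4 ℓ`
  have hFE : ∀ P : geomTorsion W ((2 ^ 2 : ℕ) : ℤ), (c₀ * γ * n) • P = c₀ • P := fun P ↦ by
    rw [mul_assoc, mul_smul, hHW _ hγn P]
  have h32 : FrobEqFrobInfty W K (2 ^ 2) ℓ := by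
    refine ⟨v, 𝔓₀, c₀ * γ * n, c₀, hℓv, h𝔓₀, hh, hc₀, fun P ↦ ?_, fun e x ↦ ?_⟩
    · exact_mod_cast hFE P
    · have hg'' : absGaloisRestrict ℚ K g' = γ * n := hg'
      rw [mul_assoc, mul_smul, ← hg'', absGaloisRestrict_smul_apply_eq g' e x]
  -- ### Step H: the congruences, and assembly
  have hℓ2 : ℓ ≠ 2 := hℓp
  have hM : 1 ≤ 2 := by norm_num
  have hdvd1 : 2 ^ 2 ∣ ℓ + 1 := pow_dvd_add_one_of_frobEqFrobInfty W (K := K) hp hM hℓ hℓ2 h32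
  have hdvd2 : ((2 : ℤ) ^ 2) ∣ W.frobeniusTrace ℓ := by
    have hd := pow_dvd_frobeniusTraceAt_of_frobEqFrobInfty W (K := K) hp hM hℓ hℓ2 h32 hℓv hgood₀
    rw [frobeniusTraceAt_eq_frobeniusTrace W v] at hd
    rwa [show ((primesEquiv v : ℕ)) = ℓ from primesEquiv_eq_of_natCast_mem hℓ hℓv] at hd
  refine ⟨ℓ, hbℓ, hℓ, hℓN', hℓD', hℓ2, hspan ▸ w.isPrime, h32, hdvd1, hdvd2, v, 𝔓₀, c₀ * γ * n, hℓv, h𝔓₀, hh, hFE, ?_,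
    w, 𝔔, τ', hwv, hℓw, h𝔔w, hτ', ?_⟩
  · rw [hhhQ]
    exact hγγ
  · rw [hresτ', hK.1, pow_two]

/-! ## §3 K4Neg's witness-prime currency -/

/-- ★★★ **THE MINUS-CASE SUPPLY IN K4Neg's WITNESS-PRIME CURRENCY** (`N := W.conductorNorm ℤ`): beyond every bound a prime `ℓ` with
`Zhang2014.IsKolyvaginPrime (W.conductorNorm ℤ) W K 2 ℓ ∧ 2 ≤ Zhang2014.kolyvaginIndex W 2 ℓ ∧ FrobEqFrobInfty W K 4 ℓ`, a Frobenius `h` at `ℓ`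
(`= c₀` on `E[4]`) with `h·h·Q − Q ≠ 0`, and a `K`-side Frobenius `τ` at the place `w ∋ ℓ` of `K` with `res τ = h·h`.  BSD / `K4Neg` NOT proved by this.
[cite: WZhang2014, Notations (xii)] [cite: GrossLMS1991, §3 (3.2)–(3.3)] [cite: McCallumLMS1991, §3 Cor. 3.2] -/
theorem exists_kolyvaginPrime_deep_sq_smul_sub_ne_of_smul_eq_neg [W.IsGloballyMinimal] [NeZero (W.conductorNorm ℤ)]
    {K : Type} [Field K] [NumberField K] (hK : IsImaginaryQuadratic K)
    {c₀ : absoluteGaloisGroup ℚ} (hc₀ : IsComplexConjugation (Rat.castHom ℝ) c₀)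
    (hce : ∃ e : geomPoints W, (2 : ℤ) • e = 0 ∧ c₀ • e ≠ e)
    {R Q' Q : geomPoints W} (hc₀R : c₀ • R = -R) (hR : ∀ σ : absoluteGaloisGroup ℚ, σ • R = R ∨ σ • R = -R)
    (hQ' : (2 : ℤ) • Q' = R) (hQ : (2 : ℤ) • Q = Q')
    {H : Subgroup (absoluteGaloisGroup ℚ)} (hHopen : IsOpen (H : Set (absoluteGaloisGroup ℚ)))
    (hHn : ∀ (σ : absoluteGaloisGroup ℚ), ∀ γ ∈ H, σ * γ * σ⁻¹ ∈ H)
    (hHW : ∀ γ ∈ H, ∀ P : geomTorsion W ((2 ^ 2 : ℕ) : ℤ), γ • P = P)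
    (hHK : ∀ γ ∈ H, ∀ x : K, γ • absEmbedding ℚ K x = absEmbedding ℚ K x)
    (hHQ' : ∀ γ ∈ H, γ • Q' = Q') (hN : ∃ γ₀ ∈ H, γ₀ • Q ≠ Q)
    (hirr : ∀ m : geomPoints W, (2 : ℤ) • m = 0 → m ≠ 0 → ∃ σ : absoluteGaloisGroup ℚ, σ • m ≠ m) (b : ℕ) :
    ∃ ℓ : ℕ, b < ℓ ∧ Zhang2014.IsKolyvaginPrime (W.conductorNorm ℤ) W K 2 ℓ ∧ 2 ≤ Zhang2014.kolyvaginIndex W 2 ℓ ∧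
      FrobEqFrobInfty W K (2 ^ 2) ℓ ∧
      ∃ (v : HeightOneSpectrum (𝓞 ℚ)) (𝔓 : Ideal (absIntegers (𝓞 ℚ) ℚ)) (h : absoluteGaloisGroup ℚ),
        (ℓ : 𝓞 ℚ) ∈ v.asIdeal ∧ 𝔓 ∈ v.primesAbove ∧ IsArithFrobAt (𝓞 ℚ) h 𝔓 ∧
        (∀ P : geomTorsion W ((2 ^ 2 : ℕ) : ℤ), h • P = c₀ • P) ∧ h • h • Q - Q ≠ 0 ∧
        ∃ (w : HeightOneSpectrum (𝓞 K)) (𝔔 : Ideal (absIntegers (𝓞 K) K)) (τ : absoluteGaloisGroup K),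
          w.under (𝓞 ℚ) = v ∧ (ℓ : 𝓞 K) ∈ w.asIdeal ∧ 𝔔 ∈ w.primesAbove ∧ IsArithFrobAt (𝓞 K) τ 𝔔 ∧ absGaloisRestrict ℚ K τ = h * h := by
  haveI : Fact (Nat.Prime 2) := ⟨Nat.prime_two⟩
  obtain ⟨ℓ, hbℓ, hℓ, hℓN, hℓD, hℓ2, hprime, h32, hdvd1, hdvd2, hrest⟩ :=
    exists_deep_frobEqFrobInfty_prime_sq_smul_sub_ne_of_smul_eq_neg W hK (W.conductorNorm ℤ) hc₀ hce hc₀R hR hQ' hQ hHopen hHn hHW hHK hHQ'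
      hN hirr b
  have hidx : 2 ≤ Zhang2014.kolyvaginIndex W 2 ℓ :=
    (Zhang2014.le_kolyvaginIndex_iff (W := W) (p := 2) (M := 2) (ℓ := ℓ)).mpr ⟨hdvd1, by exact_mod_cast hdvd2⟩
  exact ⟨ℓ, hbℓ, ⟨hℓ, hℓN, hℓD, hℓ2, hprime, lt_of_lt_of_le (by norm_num) hidx⟩, hidx, h32, hrest⟩

end Summit.BirchSwinnertonDyer.BirchSwinnertonDyer.Theorems.GenusExact.Lw2PhantomExclusion.DeepPrimeOneBit

end
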